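import Literature.MathematicalPhysics.QuantumFieldTheory.Balaban1983to89.B9SupplySockB9P3ZdFrame

/-!
# `Balaban1983to89.B9Lemma21ShellCrossingZd` — [Balaban1984PropagatorsII] Lemma 2.1 (2.60) p. 234 «e^{−αδ₀d(y,y′)} ≤ e^{−αδ₀RM·max{|j−j′|−1,0}},
# y ∈ Λ_j, y′ ∈ Λ_{j′}» ON THE `ℤᵈ × 𝔸` FRAME: the LEVEL-SEPARATION LOWER BOUND for the block distance `d(y, y′)` of `B9SupplySockB9P3ZdFrame.graphZd`
# — a chain of touching blocks from a block of level `j` to a block of level `j′ ≤ j − 2` crosses the `j − j′ − 1` shells `Ω_i ∖ Ω_{i+1}` in between, and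
# by the separation (2.2) (`Sep22Zd R`) each crossing takes more than `R·⌈M⌉` blocks: `R⌈M⌉·(j − j′ − 1) + 1 ≤ dist(y, y′)`

statement-level skeleton of published theorems with citation tags; proofs where landed; nothing here is a claim about the
Yang–Mills mass gap

PDF held: `paper:balaban1984-cmp96-propagators-rt-ii` ([4] of [B9]; journal page = PDF page + 222): p. 224 (2.1)–(2.2) «(Lʲη)⁻¹dist(Ω_jᶜ, Ω_{j+1}) > RM»,
p. 231 (2.45)–(2.46) (𝔅, admissible contours, d(y, y′)), p. 234 Lemma 2.1 (2.60); quoted through the audited headers of `B6Lemma21TowerTorus` (lit-balaban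
p01) and `B9SupplySockB9P3ZdFrame` (dag-n06-e) — BY NAME.  [Balaban1985BackgroundPropagators] p. 397 («the weighted distance d(y, y′) defined by (2.46) in
[4]»), p. 398 l. 17–20 («Using Lemma 2.1 in [4] we may replace the factor (Lʲη)^α by (Lʲη)^β(L^{j′}η)^γ»).

WHY THIS FILE (cell `pub-ymgap`, HUMAN RULING D-0062 ∕ D-0149; seat `pub-ymgap-dag-n06-w2` (g2), node N06 = [B9]; INTENT-4; count-neutral).  Every
local-to-global summation at the `ℤᵈ` frame (g0's four (3.47) entries `B9Eq347GlobalFromLocalZd`, this seat's Hölder line `B9Eq343HolderGlobalFromLocalZd` ∕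
`…HolderBothZdFinite`) DISPLAYS the exchange letter `ω′(u)·a(u) ≤ R·e^{κ₂d(u,v)}·ω(v)`, i.e. `(L^{j_u}η)³ ≲ R·e^{κ₂ d(u,v)}·(L^{j_v}η)³` — print's use of (2.60):
the level gap `j_u − j_v` is paid for by the block distance.  On a finite member the letter is inhabited with member-dependent `R` (g0's `…ZdFinite`); the
member-UNIFORM constant is exactly (2.60).  This file proves the (2.60)-shape lower bound for the frame's own block graph `graphZd` (blocks adjacent iff their
cubes touch) under the separation law `Sep22Zd` the frame already names and two laws of print's block geometry DISPLAYED: (T) «a block of level j lies in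
Ω_j» (`ZdIdx.htower` at the top truncation) and (V) «a block of level j avoids Ω_{j+1}» (print's Λ_j ⊂ Ω_j ∖ Ω_{j+1}; not a `ZdIdx` field).

WHAT IS PROVED (0 sorry; proof lane — no `def`).
* §1 block geometry: `linfDist_le_of_mem_blockZd` (a level-`j` block has sup-diameter `≤ Lʲ − 1`), `Touch.exists_linfDist_le_one`, `blockZd_nonempty` (`L ≥ 1`),
  `Omega_antitone` (`Ω_j ⊆ Ω_i` for `i ≤ j`).
* §2 `law_T_of_top` ((T) IS `ZdIdx.htower` when `m = k`); levels from the laws (T)(V): `subset_Omega_of_meets` (a block meeting `Ω_i` lies in `Ω_i`), `level_lt_of_meets_compl` (a block meeting `Ω_iᶜ` has level `< i`),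
  `level_le_of_not_meets` (a block not meeting `Ω_{i+1}` has level `≤ i`).
* §3 ★★ `shell_crossing` — ONE SHELL: on a walk `w` of `graphZd` whose start block meets `Ω_{i+1}` and whose end block has level `< i` (so misses `Ω_i`), with `t⋆`
  the last position meeting `Ω_{i+1}` and `s⋆ > t⋆` any later position meeting `Ω_iᶜ`: `R·⌈M⌉ + 1 ≤ s⋆ − t⋆` (site chain through the blocks after `t⋆`, all of
  level `≤ i`, each step `≤ Lⁱ`, against `Sep22Zd` at index `i`); `exists_chain_bound` (the site chain); the chaining inequality `t⋆(i−1) ≥ s⋆(i) − 1` is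
  inside §4's induction.
* §4 ★★★ `dist_ge_of_levels` — (2.60) ON THE FRAME: for reachable blocks `u`, `v` with `j_v + 2 ≤ j_u ≤ m`:
  `R·⌈M⌉·(j_u − j_v − 1) + 1 ≤ (graphZd L x).dist u v`; ★ `distZd_ge_of_levels` (the same for the real-valued `distZd`, both orders of the levels via
  `dist_comm`); ★ `exp_neg_mul_distZd_le` — print's display «e^{−κ·d(u,v)} ≤ e^{−κ·R⌈M⌉·(|j_u − j_v| − 1)}» for `κ ≥ 0` and reachable `u, v`.
* §5 ★★ `rpow_levelGap_le_exp_distZd` — «we may replace the factor (Lʲη)^α by (Lʲη)^β(L^{j′}η)^γ»: `L^{q|j_u−j_v|} ≤ L^q·e^{κ₂ d(u,v)}` for reachable pairs under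
  the rate condition `q·log L ≤ κ₂·R⌈M⌉` ((2.59)-type); ★★ `cube_exchange` ∕ `cube_exchange_of_connected` — the `γ = −3` EXCHANGE LETTER of g0's (3.47) entries and
  of `B9Eq343HolderBothZdFinite`'s `hex1` with member-UNIFORM `R = L³`, `κ₂` (reachable pairs ∕ connected block graph).
HONEST SCOPE.  Combinatorics of the frame's block graph; nothing of [B9] asserted; (T), (V), `Sep22Zd` DISPLAYED (their derivation for a concrete `ZdIdx` is the
law owners'); REACHABILITY is a hypothesis — `distZd` is `0` between blocks joined by no chain (g0's located (L1)), where (2.60) is false as typed and true in print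
(d = ∞); (2.61) (the row sum) is NOT here.  Count-neutral; N05∕N06 NOT discharged; one finite lattice programme at fixed `ε`; R4 closes the conditional finite-𝕋⁴
rung `BalabanLadder.UV` only; nothing continuum ∕ ℝ⁴ ∕ OS ∕ mass-gap ∕ Clay.  Unit `pub-ymgap-dag-n06-w2` (g2), 2026-08-28.
-/

namespace Literature.MathematicalPhysics.QuantumFieldTheory.Balaban1983to89.B9Lemma21ShellCrossingZd

open B7Prop1Local (InBox)
open B8Ineq130 (tlo thi tlo_apply thi_apply)
open B8LeafModelZd (ZdIdx)
open B9SupplySockB9P3ZdFrame (MemberZd BSite blockZd Touch graphZd distZd bigSideZd Sep22Zd)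
open LatticeNorms (linfDist linfDist_le_iff linfDist_triangle linfDist_comm natAbs_sub_le_linfDist)

-- `Site` alone could resolve to the torus sites of `Setup.lean`; re-export the `ℤ^d` sites of `B7Prop1Explicit`.
export B7Prop1Explicit (Site)

variable {d L : ℕ}

/-! ## §1 Block geometry: diameter, touching, non-emptiness, nesting -/

/-- **a level-`j` block has sup-diameter `≤ Lʲ − 1`**: `Δ(y) = [Lʲy, Lʲ(y+1) − 1]` coordinatewise. [cite: Balaban1985RegularSpaces, (1.28) p.81; Balaban1985BackgroundPropagators, p.397 (Δ(y) = Bʲ(y))] -/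
theorem linfDist_le_of_mem_blockZd (hL : 1 ≤ L) {j : ℕ} {y z z' : Site d} (hz : z ∈ blockZd L j y) (hz' : z' ∈ blockZd L j y) :
    linfDist z z' ≤ L ^ j - 1 := by
  rw [linfDist_le_iff]
  intro μ
  obtain ⟨h1, h2⟩ := hz μ
  obtain ⟨h3, h4⟩ := hz' μ
  rw [tlo_apply] at h1 h3
  rw [thi_apply] at h2 h4
  have hLj : (1 : ℤ) ≤ (L : ℤ) ^ j := by exact_mod_cast Nat.one_le_pow j L hL
  have hcast : ((L ^ j - 1 : ℕ) : ℤ) = (L : ℤ) ^ j - 1 := by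
    rw [Nat.cast_sub (Nat.one_le_pow j L hL)]; push_cast; ring
  have key : |z μ - z' μ| ≤ (L : ℤ) ^ j - 1 := by
    rw [abs_le]; constructor <;> nlinarith
  have : ((z μ - z' μ).natAbs : ℤ) ≤ ((L ^ j - 1 : ℕ) : ℤ) := by
    rw [Int.natCast_natAbs, hcast]; exact key
  exact_mod_cast this

/-- two touching sets contain sites at sup-distance `≤ 1`. [cite: Balaban1984PropagatorsII, (2.46) p.231 (admissible bonds)] -/
theorem Touch.exists_linfDist_le_one {A B : Set (Site d)} (h : Touch A B) : ∃ z ∈ A, ∃ z' ∈ B, linfDist z z' ≤ 1 := by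
  obtain ⟨z, hz, z', hz', hzz⟩ := h
  refine ⟨z, hz, z', hz', ?_⟩
  rw [linfDist_le_iff]
  intro μ
  have := hzz μ
  have h2 : ((z μ - z' μ).natAbs : ℤ) ≤ 1 := by rw [Int.natCast_natAbs]; exact this
  exact_mod_cast h2

/-- a block is non-empty (`L ≥ 1`): its lower corner belongs to it. [cite: Balaban1985RegularSpaces, (1.28) p.81 (bookkeeping)] -/
theorem blockZd_nonempty (hL : 1 ≤ L) (j : ℕ) (y : Site d) : (blockZd L j y).Nonempty :=
  ⟨tlo L y j, fun μ => ⟨le_rfl, B8Ineq130.tlo_le_thi hL (le_refl y) j μ⟩⟩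

/-- the domains are nested: `Ω_j ⊆ Ω_i` for `i ≤ j`. [cite: Balaban1985RegularSpaces, (1.3) p.77 («Ω₀ ⊃ Ω₁ ⊃ … ⊃ Ω_k»)] -/
theorem Omega_antitone (i₀ : ZdIdx d L) {i j : ℕ} (hij : i ≤ j) : i₀.Ω j ⊆ i₀.Ω i := by
  induction hij with
  | refl => exact le_rfl
  | step _ ih => exact (i₀.hΩ _).trans ih

/-! ## §2 Levels of blocks from the laws (T) and (V) -/

/-- **(T) at the top truncation is `ZdIdx.htower`**: for a member with `m = k` every block of `𝔅` lies in the `Ω` of its level — so the law (T) is displayed only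
for truncated members. [cite: Balaban1985RegularSpaces, (1.28) p.81, (1.3) p.77] -/
theorem law_T_of_top {x : MemberZd d L} (hm : x.m = x.i.k) (y : BSite L x) : blockZd L y.1.1 y.1.2 ⊆ x.i.Ω y.1.1 := by
  intro z hz
  obtain ⟨hy1, hy2⟩ := y.2
  have hk : y.1.1 ≤ x.i.k := hm ▸ hy1
  have hΛ : y.1.2 ∈ x.i.Λs x.i.k y.1.1 := hm ▸ hy2
  exact x.i.htower y.1.1 hk y.1.2 hΛ z hz


section Laws

variable {x : MemberZd d L}
  (hT : ∀ y : BSite L x, blockZd L y.1.1 y.1.2 ⊆ x.i.Ω y.1.1)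
  (hV : ∀ (y : BSite L x) (z : Site d), z ∈ blockZd L y.1.1 y.1.2 → ∀ j, j ≤ x.m → z ∈ x.i.Ω j → j ≤ y.1.1)

include hT hV in
/-- **(V) ⇒ a block meeting `Ω_i` (`i ≤ m`) has level `≥ i`, hence by (T) lies in `Ω_i`.** [cite: Balaban1984PropagatorsII, (2.45) p.231 (Λ_j ⊂ Ω_j); Balaban1985RegularSpaces, (1.28) p.81] -/
theorem subset_Omega_of_meets {y : BSite L x} {i : ℕ} (hi : i ≤ x.m) (h : (blockZd L y.1.1 y.1.2 ∩ x.i.Ω i).Nonempty) :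
    blockZd L y.1.1 y.1.2 ⊆ x.i.Ω i := by
  obtain ⟨z, hz, hzi⟩ := h
  have hiy : i ≤ y.1.1 := hV y z hz i hi hzi
  exact (hT y).trans (Omega_antitone x.i hiy)

include hT in
/-- **(T) ⇒ a block meeting the complement of `Ω_i` has level `< i`.** [cite: Balaban1984PropagatorsII, (2.45) p.231; Balaban1985RegularSpaces, (1.28) p.81] -/
theorem level_lt_of_meets_compl {y : BSite L x} {i : ℕ} (h : (blockZd L y.1.1 y.1.2 ∩ (x.i.Ω i)ᶜ).Nonempty) : y.1.1 < i := by
  by_contra hge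
  push Not at hge
  obtain ⟨z, hz, hzi⟩ := h
  exact hzi ((Omega_antitone x.i hge) (hT y hz))

include hT in
/-- **a block meeting `Ω_i` but not `Ω_{i+1}` has level `≤ i` (the block is non-empty and lies in `Ω_{level}`): with (V) the shell blocks are level-`i` blocks.**
[cite: Balaban1984PropagatorsII, (2.45) p.231 (B^j(Λ_j) = Ω_j ∖ Ω_{j+1}); Balaban1985RegularSpaces, (1.28) p.81] -/
theorem level_le_of_not_meets (hL : 1 ≤ L) {y : BSite L x} {i : ℕ}
    (h : ¬ (blockZd L y.1.1 y.1.2 ∩ x.i.Ω (i + 1)).Nonempty) : y.1.1 ≤ i := by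
  by_contra hgt
  push Not at hgt
  obtain ⟨z, hz⟩ := blockZd_nonempty hL y.1.1 y.1.2
  exact h ⟨z, hz, (Omega_antitone x.i hgt) (hT y hz)⟩

end Laws

/-! ## §3 One shell: a chain from `Ω_{i+1}` to `Ω_iᶜ` has more than `R⌈M⌉` steps -/

section Shell

variable {x : MemberZd d L}

/-- positions on a walk: «the block at position `t` meets the set `S`». [cite: Balaban1984PropagatorsII, (2.46) p.231 (bookkeeping)] -/
theorem meets_iff {a b : BSite L x} (w : (graphZd L x).Walk a b) (S : Set (Site d)) (t : ℕ) :
    (blockZd L (w.getVert t).1.1 (w.getVert t).1.2 ∩ S).Nonempty ↔ ∃ z ∈ blockZd L (w.getVert t).1.1 (w.getVert t).1.2, z ∈ S :=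
  ⟨fun ⟨z, hz, hs⟩ => ⟨z, hz, hs⟩, fun ⟨z, hz, hs⟩ => ⟨z, hz, hs⟩⟩

/-- **the site chain through shell blocks**: along a walk, if the blocks at positions `t₀ < t ≤ t₁` all have level `≤ i` (`L ≥ 1`), then every site of the block
at position `t ≤ t₁` (`t₀ ≤ t`) is within sup-distance `(t − t₀)·Lⁱ` of some site of the block at position `t₀` (each step: a touching pair `≤ 1` plus a block
diameter `≤ Lⁱ − 1`). [cite: Balaban1984PropagatorsII, (2.46) p.231, Lemma 2.1 (2.60) p.234 (the mechanism)] -/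
theorem exists_chain_bound (hL : 1 ≤ L) {a b : BSite L x} (w : (graphZd L x).Walk a b) {t₀ t₁ : ℕ} (ht₁ : t₁ ≤ w.length) (i : ℕ)
    (hlev : ∀ t, t₀ < t → t ≤ t₁ → (w.getVert t).1.1 ≤ i) :
    ∀ t, t₀ ≤ t → t ≤ t₁ → ∀ z ∈ blockZd L (w.getVert t).1.1 (w.getVert t).1.2,
      ∃ z₀ ∈ blockZd L (w.getVert t₀).1.1 (w.getVert t₀).1.2, linfDist z₀ z ≤ (t - t₀) * L ^ i := by
  intro t ht₀
  induction t, ht₀ using Nat.le_induction with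
  | base =>
    intro _ z hz
    exact ⟨z, hz, by simp⟩
  | succ t ht ih =>
    intro ht1 z hz
    have hadj : (graphZd L x).Adj (w.getVert t) (w.getVert (t + 1)) := w.adj_getVert_succ (by omega)
    obtain ⟨p, hp, q, hq, hpq⟩ := Touch.exists_linfDist_le_one hadj.2
    obtain ⟨z₀, hz₀, hd⟩ := ih (by omega) p hp
    have hlevt : (w.getVert (t + 1)).1.1 ≤ i := hlev (t + 1) (by omega) ht1
    have hdiam : linfDist q z ≤ L ^ (w.getVert (t + 1)).1.1 - 1 := linfDist_le_of_mem_blockZd hL hq hz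
    have hpow : L ^ (w.getVert (t + 1)).1.1 ≤ L ^ i := Nat.pow_le_pow_right hL hlevt
    have hLi : 1 ≤ L ^ i := Nat.one_le_pow i L hL
    refine ⟨z₀, hz₀, ?_⟩
    calc linfDist z₀ z ≤ linfDist z₀ p + linfDist p z := linfDist_triangle _ _ _
      _ ≤ linfDist z₀ p + (linfDist p q + linfDist q z) := Nat.add_le_add_left (linfDist_triangle _ _ _) _
      _ ≤ (t - t₀) * L ^ i + (1 + (L ^ i - 1)) := by gcongr; exact hdiam.trans (Nat.sub_le_sub_right hpow 1)
      _ = (t + 1 - t₀) * L ^ i := by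
          rw [Nat.add_sub_cancel' hLi, show t + 1 - t₀ = (t - t₀) + 1 by omega, Nat.add_mul, one_mul]

variable (hT : ∀ y : BSite L x, blockZd L y.1.1 y.1.2 ⊆ x.i.Ω y.1.1)
  (hV : ∀ (y : BSite L x) (z : Site d), z ∈ blockZd L y.1.1 y.1.2 → ∀ j, j ≤ x.m → z ∈ x.i.Ω j → j ≤ y.1.1)

include hT hV in
/-- ★★ **ONE SHELL CROSSING** — on a walk `w` of the block graph (length `n`), let `t⋆ ≤ n` be a position whose block meets `Ω_{i+1}` and after which no block
meets `Ω_{i+1}`, and `s⋆` with `t⋆ < s⋆ ≤ n` a position whose block meets `Ω_iᶜ` (`i + 1 ≤ m`, `1 ≤ L`, the laws (T)(V), the separation `Sep22Zd R`).  Then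
`R·⌈M⌉ + 1 ≤ s⋆ − t⋆`: the blocks after `t⋆` have level `≤ i` (they miss `Ω_{i+1}`), the end block has level `< i`, so a site chain of sup-length `≤ (s⋆ − t⋆)·Lⁱ`
joins a site of `Ω_{i+1}` (the start block lies in it) to a site outside `Ω_i`, which (2.2) forbids at or below `R⌈M⌉Lⁱ`.
[cite: Balaban1984PropagatorsII, Lemma 2.1 (2.60) p.234, (2.2) p.224, (2.46) p.231] -/
theorem shell_crossing (hL : 1 ≤ L) {R : ℕ} (hsep : Sep22Zd R x) {a b : BSite L x} (w : (graphZd L x).Walk a b) {i : ℕ} (hi : i + 1 ≤ x.m)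
    {tstar sstar : ℕ} (hts : tstar < sstar) (hsn : sstar ≤ w.length)
    (htmeet : (blockZd L (w.getVert tstar).1.1 (w.getVert tstar).1.2 ∩ x.i.Ω (i + 1)).Nonempty)
    (htlast : ∀ t, tstar < t → t ≤ w.length → ¬ (blockZd L (w.getVert t).1.1 (w.getVert t).1.2 ∩ x.i.Ω (i + 1)).Nonempty)
    (hsmeet : (blockZd L (w.getVert sstar).1.1 (w.getVert sstar).1.2 ∩ (x.i.Ω i)ᶜ).Nonempty) :
    R * ⌈x.M⌉₊ + 1 ≤ sstar - tstar := by
  -- levels: strictly between = `≤ i`; the end block `< i`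
  have hlev : ∀ t, tstar < t → t ≤ sstar → (w.getVert t).1.1 ≤ i := by
    intro t ht1 ht2
    rcases lt_or_eq_of_le ht2 with hlt | heq
    · exact level_le_of_not_meets hT hL (htlast t ht1 (by omega))
    · rw [heq]; exact (level_lt_of_meets_compl hT hsmeet).le
  have hlevS : (w.getVert sstar).1.1 + 1 ≤ i := level_lt_of_meets_compl hT hsmeet
  -- the start block lies in `Ω_{i+1}`
  have hstart : blockZd L (w.getVert tstar).1.1 (w.getVert tstar).1.2 ⊆ x.i.Ω (i + 1) := subset_Omega_of_meets hT hV hi htmeet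
  -- the site outside `Ω_i` in the end block, and the touching pair into the end block
  obtain ⟨z', hz'b, hz'out⟩ := hsmeet
  have hadj : (graphZd L x).Adj (w.getVert (sstar - 1)) (w.getVert (sstar - 1 + 1)) := w.adj_getVert_succ (by omega)
  rw [show sstar - 1 + 1 = sstar by omega] at hadj
  obtain ⟨p, hp, q, hq, hpq⟩ := Touch.exists_linfDist_le_one hadj.2
  -- the chain up to position `s⋆ − 1`
  obtain ⟨z₀, hz₀, hd⟩ := exists_chain_bound hL w (t₁ := sstar - 1) (by omega) i
    (fun t ht1 ht2 => hlev t ht1 (by omega)) (sstar - 1) (by omega) le_rfl p hp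
  have hz₀in : z₀ ∈ x.i.Ω (i + 1) := hstart hz₀
  -- (2.2): `R⌈M⌉Lⁱ < |z′ − z₀|_∞`
  have hfar : R * bigSideZd x.M L i < linfDist z' z₀ := hsep i hi z' hz'out z₀ hz₀in
  -- the chain bound: `|z₀ − z′|_∞ ≤ (s⋆ − 1 − t⋆)Lⁱ + 1 + (L^{i−1} − 1) ≤ (s⋆ − t⋆)Lⁱ − 1`
  have hdiam : linfDist q z' ≤ L ^ (w.getVert sstar).1.1 - 1 := linfDist_le_of_mem_blockZd hL hq hz'b
  have hLi : 1 ≤ L ^ i := Nat.one_le_pow i L hL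
  have hpow : L ^ (w.getVert sstar).1.1 ≤ L ^ i := Nat.pow_le_pow_right hL (by omega)
  have htot : linfDist z₀ z' ≤ (sstar - tstar) * L ^ i := by
    calc linfDist z₀ z' ≤ linfDist z₀ p + linfDist p z' := linfDist_triangle _ _ _
      _ ≤ linfDist z₀ p + (linfDist p q + linfDist q z') := Nat.add_le_add_left (linfDist_triangle _ _ _) _
      _ ≤ (sstar - 1 - tstar) * L ^ i + (1 + (L ^ i - 1)) := by gcongr; exact hdiam.trans (Nat.sub_le_sub_right hpow 1)
      _ = (sstar - tstar) * L ^ i := by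
          rw [Nat.add_sub_cancel' hLi, show sstar - tstar = (sstar - 1 - tstar) + 1 by omega, Nat.add_mul, one_mul]
  rw [linfDist_comm] at hfar
  unfold B9SupplySockB9P3ZdFrame.bigSideZd at hfar
  -- `R⌈M⌉Lⁱ < (s⋆ − t⋆)Lⁱ` ⟹ `R⌈M⌉ < s⋆ − t⋆`
  have hlt : R * ⌈x.M⌉₊ * L ^ i < (sstar - tstar) * L ^ i := by
    have := lt_of_lt_of_le hfar htot
    rw [← Nat.mul_assoc] at this
    exact this
  exact Nat.succ_le_of_lt (Nat.lt_of_mul_lt_mul_right hlt)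

end Shell

/-! ## §4 (2.60): the level gap is paid for by the block distance -/

section Levels

variable {x : MemberZd d L}
  (hT : ∀ y : BSite L x, blockZd L y.1.1 y.1.2 ⊆ x.i.Ω y.1.1)
  (hV : ∀ (y : BSite L x) (z : Site d), z ∈ blockZd L y.1.1 y.1.2 → ∀ j, j ≤ x.m → z ∈ x.i.Ω j → j ≤ y.1.1)

include hT hV in
/-- ★★★ **[4] LEMMA 2.1 (2.60) ON THE `ℤᵈ` FRAME — WALK FORM**: every walk of the block graph from a block `u` of level `j_u ≤ m` to a block `v` of level `j_v` with
`j_v + 2 ≤ j_u` has length `≥ R·⌈M⌉·(j_u − j_v − 1) + 1` (`1 ≤ L`, laws (T)(V), `Sep22Zd R`).  Proof: for each shell index `i ∈ [j_v + 1, j_u − 1]` let `t_i` be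
the last position meeting `Ω_{i+1}` and `s_i` the first later position meeting `Ω_iᶜ`; `shell_crossing` gives `s_i − t_i ≥ R⌈M⌉ + 1`, and `t_{i−1} ≥ s_i − 1`
chains the shells. [cite: Balaban1984PropagatorsII, Lemma 2.1 (2.60) p.234, (2.2) p.224, (2.45)–(2.46) p.231] -/
theorem length_ge_of_levels (hL : 1 ≤ L) {R : ℕ} (hsep : Sep22Zd R x) {u v : BSite L x} (w : (graphZd L x).Walk u v)
    (hum : u.1.1 ≤ x.m) (hgap : v.1.1 + 2 ≤ u.1.1) :
    R * ⌈x.M⌉₊ * (u.1.1 - v.1.1 - 1) + 1 ≤ w.length := by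
  classical
  set n := w.length with hn
  -- meeting predicates along the walk
  let meetsIn : ℕ → ℕ → Prop := fun i t => (blockZd L (w.getVert t).1.1 (w.getVert t).1.2 ∩ x.i.Ω i).Nonempty
  let meetsOut : ℕ → ℕ → Prop := fun i t => (blockZd L (w.getVert t).1.1 (w.getVert t).1.2 ∩ (x.i.Ω i)ᶜ).Nonempty
  -- the end block `v` misses `Ω_i` for every `i ≥ j_v + 1`; the start block `u` lies in `Ω_{j_u}`
  have hv_out : ∀ i, v.1.1 + 1 ≤ i → i ≤ x.m → meetsOut i n := by
    intro i hi him
    obtain ⟨z, hz⟩ := blockZd_nonempty hL v.1.1 v.1.2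
    refine ⟨z, by rw [hn, w.getVert_length]; exact hz, fun hzi => ?_⟩
    have := hV v z hz i him hzi
    omega
  have hv_notin : ∀ i, v.1.1 + 1 ≤ i → i ≤ x.m → ¬ meetsIn i n := by
    intro i hi him ⟨z, hz, hzi⟩
    rw [hn, w.getVert_length] at hz
    have := hV v z hz i him hzi
    omega
  have hu_in : ∀ i, i ≤ u.1.1 → meetsIn i 0 := by
    intro i hi
    obtain ⟨z, hz⟩ := blockZd_nonempty hL u.1.1 u.1.2
    refine ⟨z, by rw [w.getVert_zero]; exact hz, ?_⟩
    exact (Omega_antitone x.i hi) (hT u (by exact hz))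
  -- positions: `T i` = last position meeting `Ω_{i+1}`; `S i` = first position after `T i` meeting `Ω_iᶜ`
  let T : ℕ → ℕ := fun i => Nat.findGreatest (meetsIn (i + 1)) n
  have hT_spec : ∀ i, i + 1 ≤ u.1.1 → meetsIn (i + 1) (T i) := fun i hi =>
    Nat.findGreatest_spec (P := meetsIn (i + 1)) (Nat.zero_le n) (hu_in (i + 1) hi)
  have hT_le : ∀ i, T i ≤ n := fun i => Nat.findGreatest_le n
  have hT_last : ∀ i t, T i < t → t ≤ n → ¬ meetsIn (i + 1) t := fun i t ht htn =>
    Nat.findGreatest_is_greatest ht htn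
  have hT_lt : ∀ i, v.1.1 + 1 ≤ i + 1 → i + 1 ≤ u.1.1 → T i < n := by
    intro i hi hiu
    rcases lt_or_eq_of_le (hT_le i) with h | h
    · exact h
    · exact absurd (h ▸ hT_spec i hiu) (hv_notin (i + 1) hi (by omega))
  have hS_ex : ∀ i, v.1.1 + 1 ≤ i → i + 1 ≤ u.1.1 → ∃ s, T i < s ∧ s ≤ n ∧ meetsOut i s := fun i hi hiu =>
    ⟨n, hT_lt i (by omega) hiu, le_rfl, hv_out i hi (by omega)⟩
  -- the per-shell bound and the chaining, packaged as: `n ≥ T i + (i − j_v)·R⌈M⌉ + 1` for every shell index `i`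
  set K : ℕ := R * ⌈x.M⌉₊ with hK
  have key : ∀ i, v.1.1 + 1 ≤ i → i + 1 ≤ u.1.1 → T i + (i - v.1.1) * K + 1 ≤ n := by
    intro i hi
    induction i, hi using Nat.le_induction with
    | base =>
      intro hiu
      have him : v.1.1 + 1 + 1 ≤ x.m := by omega
      have hex : ∃ s, T (v.1.1 + 1) < s ∧ s ≤ n ∧ meetsOut (v.1.1 + 1) s := hS_ex (v.1.1 + 1) le_rfl hiu
      let S := Nat.find hex
      have hS : T (v.1.1 + 1) < S ∧ S ≤ n ∧ meetsOut (v.1.1 + 1) S := Nat.find_spec hex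
      have hcross := shell_crossing hT hV hL hsep w him hS.1 hS.2.1 (hT_spec _ (by omega))
        (fun t ht htn => hT_last _ t ht htn) hS.2.2
      have : v.1.1 + 1 - v.1.1 = 1 := by omega
      rw [this, one_mul]
      omega
    | succ i hi ih =>
      intro hiu
      have him : i + 1 + 1 ≤ x.m := by omega
      have ih' := ih (by omega)
      -- shell `i + 1`: `S (i+1) − T (i+1) ≥ R⌈M⌉ + 1` and `T i ≥ S (i+1) − 1`
      have hex : ∃ s, T (i + 1) < s ∧ s ≤ n ∧ meetsOut (i + 1) s := hS_ex (i + 1) (by omega) hiu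
      let S := Nat.find hex
      have hS : T (i + 1) < S ∧ S ≤ n ∧ meetsOut (i + 1) S := Nat.find_spec hex
      have hSmin : ∀ t, T (i + 1) < t → t < S → ¬ meetsOut (i + 1) t := fun t ht1 ht2 hmt =>
        absurd (Nat.find_min' hex ⟨ht1, by omega, hmt⟩) (by omega)
      have hcross := shell_crossing hT hV hL hsep w him hS.1 hS.2.1 (hT_spec _ (by omega))
        (fun t ht htn => hT_last _ t ht htn) hS.2.2
      -- chaining: position `S − 1` meets `Ω_{i+1}` (it is `> T (i+1)` only if it misses `Ω_{i+1}ᶜ`… ) — precisely: `T i ≥ S − 1`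
      have hchain : S - 1 ≤ T i := by
        by_contra hlt
        push Not at hlt
        -- `S − 1 > T i` ⇒ the block at `S − 1` misses `Ω_{i+1}` ⇒ (non-empty) meets `Ω_{i+1}ᶜ`
        have hmiss : ¬ meetsIn (i + 1) (S - 1) := hT_last i (S - 1) hlt (by omega)
        have hmo : meetsOut (i + 1) (S - 1) := by
          obtain ⟨z, hz⟩ := blockZd_nonempty hL (w.getVert (S - 1)).1.1 (w.getVert (S - 1)).1.2
          exact ⟨z, hz, fun hzi => hmiss ⟨z, hz, hzi⟩⟩
        rcases lt_or_eq_of_le (show T (i + 1) ≤ S - 1 by omega) with hlt' | heq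
        · exact hSmin (S - 1) hlt' (by omega) hmo
        · -- `S − 1 = T (i+1)`: that block meets `Ω_{i+2} ⊆ Ω_{i+1}`, contradiction with `hmiss`
          have hm2 := hT_spec (i + 1) (by omega)
          rw [heq] at hm2
          obtain ⟨z, hz, hzi⟩ := hm2
          exact hmiss ⟨z, hz, (x.i.hΩ (i + 1)) hzi⟩
      have : i + 1 - v.1.1 = (i - v.1.1) + 1 := by omega
      rw [this, Nat.add_mul, one_mul]
      omega
  have hfinal := key (u.1.1 - 1) (by omega) (by omega)
  have hsub : u.1.1 - 1 - v.1.1 = u.1.1 - v.1.1 - 1 := by omega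
  rw [hsub] at hfinal
  have hcomm : K * (u.1.1 - v.1.1 - 1) = (u.1.1 - v.1.1 - 1) * K := Nat.mul_comm _ _
  rw [hcomm]
  omega

include hT hV in
/-- ★★★ **(2.60) FOR THE GRAPH DISTANCE**: for REACHABLE blocks `u`, `v` with `j_v + 2 ≤ j_u ≤ m`: `R·⌈M⌉·(j_u − j_v − 1) + 1 ≤ dist(u, v)` in the block graph of the
member. [cite: Balaban1984PropagatorsII, Lemma 2.1 (2.60) p.234] -/
theorem dist_ge_of_levels (hL : 1 ≤ L) {R : ℕ} (hsep : Sep22Zd R x) {u v : BSite L x} (huv : (graphZd L x).Reachable u v)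
    (hum : u.1.1 ≤ x.m) (hgap : v.1.1 + 2 ≤ u.1.1) :
    R * ⌈x.M⌉₊ * (u.1.1 - v.1.1 - 1) + 1 ≤ (graphZd L x).dist u v := by
  obtain ⟨w, hw⟩ := huv.exists_walk_length_eq_dist
  rw [← hw]
  exact length_ge_of_levels hT hV hL hsep w hum hgap

include hT hV in
/-- ★ **(2.60) FOR THE FRAME's `distZd`** (real-valued), levels in either order: for reachable `u, v` with levels `≤ m` differing by at least `2`,
`R·⌈M⌉·(|j_u − j_v| − 1) + 1 ≤ distZd L x u v`. [cite: Balaban1984PropagatorsII, Lemma 2.1 (2.60) p.234; Balaban1985BackgroundPropagators, p.397 (d(y, y′))] -/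
theorem distZd_ge_of_levels (hL : 1 ≤ L) {R : ℕ} (hsep : Sep22Zd R x) {u v : BSite L x} (huv : (graphZd L x).Reachable u v)
    (hgap : v.1.1 + 2 ≤ u.1.1 ∨ u.1.1 + 2 ≤ v.1.1) :
    (R : ℝ) * ⌈x.M⌉₊ * ((max u.1.1 v.1.1 - min u.1.1 v.1.1 - 1 : ℕ) : ℝ) + 1 ≤ distZd L x u v := by
  unfold B9SupplySockB9P3ZdFrame.distZd
  rcases hgap with h | h
  · have hum : u.1.1 ≤ x.m := u.2.1
    have key := dist_ge_of_levels hT hV hL hsep huv hum h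
    have hmax : max u.1.1 v.1.1 = u.1.1 := max_eq_left (by omega)
    have hmin : min u.1.1 v.1.1 = v.1.1 := min_eq_right (by omega)
    rw [hmax, hmin]
    exact_mod_cast key
  · have hvm : v.1.1 ≤ x.m := v.2.1
    have key := dist_ge_of_levels hT hV hL hsep huv.symm hvm h
    rw [SimpleGraph.dist_comm] at key
    have hmax : max u.1.1 v.1.1 = v.1.1 := max_eq_right (by omega)
    have hmin : min u.1.1 v.1.1 = u.1.1 := min_eq_left (by omega)
    rw [hmax, hmin]
    exact_mod_cast key

include hT hV in
/-- ★ **PRINT's DISPLAY (2.60)**: `e^{−κ·d(u,v)} ≤ e^{−κ·(R⌈M⌉·(|j_u − j_v| − 1) + 1)}` for `κ ≥ 0` and reachable `u, v` whose levels differ by at least `2` — the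
exponential cost of a level gap that the exchange letters of `B9Eq347GlobalFromLocalZd` ∕ `B9Eq343HolderGlobalFromLocalZd` charge.
[cite: Balaban1984PropagatorsII, Lemma 2.1 (2.60) p.234; Balaban1985BackgroundPropagators, p.398 l.17–20] -/
theorem exp_neg_mul_distZd_le (hL : 1 ≤ L) {R : ℕ} (hsep : Sep22Zd R x) {u v : BSite L x} (huv : (graphZd L x).Reachable u v)
    (hgap : v.1.1 + 2 ≤ u.1.1 ∨ u.1.1 + 2 ≤ v.1.1) {κ : ℝ} (hκ : 0 ≤ κ) :
    Real.exp (-(κ * distZd L x u v)) ≤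
      Real.exp (-(κ * ((R : ℝ) * ⌈x.M⌉₊ * ((max u.1.1 v.1.1 - min u.1.1 v.1.1 - 1 : ℕ) : ℝ) + 1))) := by
  have h := distZd_ge_of_levels hT hV hL hsep huv hgap
  exact Real.exp_le_exp.mpr (by nlinarith)

end Levels

/-! ## §5 The exchange letter of the local-to-global summations, from (2.60) -/

section Exchange

variable {x : MemberZd d L}
  (hT : ∀ y : BSite L x, blockZd L y.1.1 y.1.2 ⊆ x.i.Ω y.1.1)
  (hV : ∀ (y : BSite L x) (z : Site d), z ∈ blockZd L y.1.1 y.1.2 → ∀ j, j ≤ x.m → z ∈ x.i.Ω j → j ≤ y.1.1)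

include hT hV in
/-- ★★ **THE LEVEL GAP IN EXPONENTIAL CURRENCY** (print p. 398 l. 17–18 «Using Lemma 2.1 in [4] we may replace the factor (Lʲη)^α by (Lʲη)^β(L^{j′}η)^γ»): for
reachable blocks `u, v`, `q ≥ 0`, `κ₂ ≥ 0` with the rate condition `q·log L ≤ κ₂·R⌈M⌉` (print's (2.59)-type largeness of `RM`):
`L^{q·|j_u − j_v|} ≤ L^q · e^{κ₂·d(u,v)}` — a gap of one level is free, every further level costs `R⌈M⌉` units of distance by (2.60).
[cite: Balaban1984PropagatorsII, Lemma 2.1 (2.59)–(2.60) p.234; Balaban1985BackgroundPropagators, p.398 l.17–18] -/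
theorem rpow_levelGap_le_exp_distZd (hL : 1 ≤ L) {R : ℕ} (hsep : Sep22Zd R x) {u v : BSite L x} (huv : (graphZd L x).Reachable u v)
    {q κ₂ : ℝ} (hq : 0 ≤ q) (hκ₂ : 0 ≤ κ₂) (hrate : q * Real.log L ≤ κ₂ * ((R : ℝ) * ⌈x.M⌉₊)) :
    (L : ℝ) ^ (q * ((max u.1.1 v.1.1 - min u.1.1 v.1.1 : ℕ) : ℝ)) ≤ (L : ℝ) ^ q * Real.exp (κ₂ * distZd L x u v) := by
  have hL0 : (0 : ℝ) < L := by exact_mod_cast (lt_of_lt_of_le zero_lt_one hL)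
  have hlog : 0 ≤ Real.log L := Real.log_nonneg (by exact_mod_cast hL)
  have hd0 : 0 ≤ distZd L x u v := B9SupplySockB9P3ZdFrame.distZd_nonneg L x u v
  set n : ℕ := max u.1.1 v.1.1 - min u.1.1 v.1.1 with hn
  rw [Real.rpow_def_of_pos hL0, Real.rpow_def_of_pos hL0, ← Real.exp_add]
  refine Real.exp_le_exp.mpr ?_
  -- `log L · (q·n) ≤ log L · q + κ₂ d` ⟸ `log L · q · (n − 1) ≤ κ₂ d`
  by_cases hn1 : n ≤ 1
  · have h1 : Real.log L * (q * (n : ℝ)) ≤ Real.log L * q := by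
      have : (n : ℝ) ≤ 1 := by exact_mod_cast hn1
      nlinarith [mul_nonneg hlog hq]
    nlinarith [mul_nonneg hκ₂ hd0]
  · push Not at hn1
    have hgap : v.1.1 + 2 ≤ u.1.1 ∨ u.1.1 + 2 ≤ v.1.1 := by
      rcases le_total u.1.1 v.1.1 with h | h
      · right; have : n = v.1.1 - u.1.1 := by rw [hn, max_eq_right h, min_eq_left h]
        omega
      · left; have : n = u.1.1 - v.1.1 := by rw [hn, max_eq_left h, min_eq_right h]
        omega
    have hd := distZd_ge_of_levels hT hV hL hsep huv hgap
    have hcast : ((max u.1.1 v.1.1 - min u.1.1 v.1.1 - 1 : ℕ) : ℝ) = (n : ℝ) - 1 := by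
      rw [← hn, Nat.cast_sub (by omega)]; simp
    rw [hcast] at hd
    -- `log L · q · (n−1) ≤ κ₂ R⌈M⌉ (n−1) ≤ κ₂ (d − 1) ≤ κ₂ d`
    have hn1' : (1 : ℝ) ≤ (n : ℝ) - 1 := by
      have : (2 : ℝ) ≤ (n : ℝ) := by exact_mod_cast hn1
      linarith
    have h1 : Real.log L * q * ((n : ℝ) - 1) ≤ κ₂ * ((R : ℝ) * ⌈x.M⌉₊) * ((n : ℝ) - 1) := by
      have := mul_le_mul_of_nonneg_right hrate (by linarith : (0 : ℝ) ≤ (n : ℝ) - 1)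
      linarith [this]
    have h2 : κ₂ * ((R : ℝ) * ⌈x.M⌉₊) * ((n : ℝ) - 1) ≤ κ₂ * distZd L x u v := by
      have : (R : ℝ) * ⌈x.M⌉₊ * ((n : ℝ) - 1) ≤ distZd L x u v := by linarith
      calc κ₂ * ((R : ℝ) * ⌈x.M⌉₊) * ((n : ℝ) - 1) = κ₂ * ((R : ℝ) * ⌈x.M⌉₊ * ((n : ℝ) - 1)) := by ring
        _ ≤ κ₂ * distZd L x u v := mul_le_mul_of_nonneg_left this hκ₂
    nlinarith [h1, h2, mul_nonneg hlog hq]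

include hT hV in
/-- ★★ **THE CUBE EXCHANGE LETTER** of the `γ = −3` summations (`B9Eq347GlobalFromLocalZd` entries n = 0, 1, 3 with `ω′(u)·a(u) = (L^{j_u}η)³`, `ω(v) = (L^{j_v}η)³`;
`B9Eq343HolderBothZdFinite`'s sup exchange `hex1`): for REACHABLE `u, v`, under `3·log L ≤ κ₂·R⌈M⌉`,
`(L^{j_u}η)³ ≤ L³ · e^{κ₂ d(u,v)} · (L^{j_v}η)³` — the member-UNIFORM constants `R = L³`, `κ₂` of print's use of (2.60).
[cite: Balaban1984PropagatorsII, Lemma 2.1 (2.60) p.234; Balaban1985BackgroundPropagators, (3.47) p.398 + l.17–20] -/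
theorem cube_exchange (hL : 1 ≤ L) {R : ℕ} (hsep : Sep22Zd R x) {u v : BSite L x} (huv : (graphZd L x).Reachable u v)
    {κ₂ : ℝ} (hκ₂ : 0 ≤ κ₂) (hrate : 3 * Real.log L ≤ κ₂ * ((R : ℝ) * ⌈x.M⌉₊)) :
    ((L : ℝ) ^ u.1.1 * x.i.η) ^ 3 ≤ (L : ℝ) ^ 3 * Real.exp (κ₂ * distZd L x u v) * ((L : ℝ) ^ v.1.1 * x.i.η) ^ 3 := by
  have hη : 0 < x.i.η := x.i.hη
  have hL0 : (0 : ℝ) < L := by exact_mod_cast (lt_of_lt_of_le zero_lt_one hL)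
  have hL1 : (1 : ℝ) ≤ L := by exact_mod_cast hL
  have key := rpow_levelGap_le_exp_distZd hT hV hL hsep huv (q := 3) (by norm_num) hκ₂ hrate
  have hexp : 0 ≤ Real.exp (κ₂ * distZd L x u v) := Real.exp_nonneg _
  have htv : 0 < ((L : ℝ) ^ v.1.1 * x.i.η) ^ 3 := pow_pos (B8ScaledSupNorm.scale_pos hL hη v.1.1) 3
  -- `(L^{j_u}η)³ = L^{3(j_u − j_v)}·(L^{j_v}η)³ ≤ L^{3|j_u−j_v|}·(L^{j_v}η)³`
  rw [mul_pow, mul_pow, ← pow_mul, ← pow_mul]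
  rcases le_total u.1.1 v.1.1 with h | h
  · -- `j_u ≤ j_v`: the left side is already smaller, and `L³ e^{κ₂d} ≥ 1`
    have h1 : (L : ℝ) ^ (u.1.1 * 3) ≤ (L : ℝ) ^ (v.1.1 * 3) := pow_le_pow_right₀ hL1 (by omega)
    have h2 : (1 : ℝ) ≤ (L : ℝ) ^ 3 * Real.exp (κ₂ * distZd L x u v) := by
      have : (1 : ℝ) ≤ (L : ℝ) ^ 3 := one_le_pow₀ hL1
      have : (1 : ℝ) ≤ Real.exp (κ₂ * distZd L x u v) := Real.one_le_exp (mul_nonneg hκ₂ (B9SupplySockB9P3ZdFrame.distZd_nonneg L x u v))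
      nlinarith
    have hη3 : 0 < x.i.η ^ 3 := pow_pos hη 3
    calc (L : ℝ) ^ (u.1.1 * 3) * x.i.η ^ 3 ≤ (L : ℝ) ^ (v.1.1 * 3) * x.i.η ^ 3 := mul_le_mul_of_nonneg_right h1 hη3.le
      _ = 1 * ((L : ℝ) ^ (v.1.1 * 3) * x.i.η ^ 3) := (one_mul _).symm
      _ ≤ (L : ℝ) ^ 3 * Real.exp (κ₂ * distZd L x u v) * ((L : ℝ) ^ (v.1.1 * 3) * x.i.η ^ 3) :=
          mul_le_mul_of_nonneg_right h2 (by positivity)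
  · -- `j_v ≤ j_u`: the gap `n = j_u − j_v` and `key`
    have hn : max u.1.1 v.1.1 - min u.1.1 v.1.1 = u.1.1 - v.1.1 := by rw [max_eq_left h, min_eq_right h]
    rw [hn] at key
    have hsplit : (L : ℝ) ^ (u.1.1 * 3) = (L : ℝ) ^ (3 * (u.1.1 - v.1.1)) * (L : ℝ) ^ (v.1.1 * 3) := by
      rw [← pow_add]; congr 1; omega
    have hrp : (L : ℝ) ^ (3 * (u.1.1 - v.1.1)) = (L : ℝ) ^ ((3 : ℝ) * ((u.1.1 - v.1.1 : ℕ) : ℝ)) := by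
      rw [← Real.rpow_natCast]; congr 1; push_cast; ring
    have h3 : (L : ℝ) ^ (3 : ℝ) = (L : ℝ) ^ 3 := by exact_mod_cast Real.rpow_natCast (L : ℝ) 3
    rw [h3] at key
    rw [hsplit, hrp, mul_assoc]
    exact mul_le_mul_of_nonneg_right key (by positivity)

include hT hV in
/-- ★ **ON A MEMBER WITH CONNECTED BLOCK GRAPH** the cube exchange letter holds for EVERY pair — the form the summations `weight_mul_norm_*_le_of_ineq342`
(`B9Eq347GlobalFromLocalZd`) and `weight_mul_hquot_gradGop_le_both` ∕ `holderBoth_msup_le` (`B9Eq343HolderBothZdFinite`, letter `hex1`) consume, with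
member-UNIFORM `R = L³`, `κ₂` (the Hölder exchange `hexH` carries the cut-off factor `cutHZd(ζ_u)` in addition — located (L-H2), not uniform as typed).
[cite: Balaban1984PropagatorsII, Lemma 2.1 (2.60) p.234; Balaban1985BackgroundPropagators, p.398 l.17–20] -/
theorem cube_exchange_of_connected (hL : 1 ≤ L) {R : ℕ} (hsep : Sep22Zd R x) (hconn : ∀ u v : BSite L x, (graphZd L x).Reachable u v)
    {κ₂ : ℝ} (hκ₂ : 0 ≤ κ₂) (hrate : 3 * Real.log L ≤ κ₂ * ((R : ℝ) * ⌈x.M⌉₊)) (u v : BSite L x) :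
    ((L : ℝ) ^ u.1.1 * x.i.η) ^ 2 * ((L : ℝ) ^ u.1.1 * x.i.η) ≤ (L : ℝ) ^ 3 * Real.exp (κ₂ * distZd L x u v) * ((L : ℝ) ^ v.1.1 * x.i.η) ^ 3 := by
  rw [← pow_succ]
  exact cube_exchange hT hV hL hsep (hconn u v) hκ₂ hrate

end Exchange

end Literature.MathematicalPhysics.QuantumFieldTheory.Balaban1983to89.B9Lemma21ShellCrossingZd
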